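import Summits.Ventures.HodgeRepro2.T5InertUnipotentResidue

/-!
# The residue involution and `#𝔽 = #{trace zero}²`
(cell pub-hodge-repro2, seat p3)

Tier-5 N3 support, towards the printed form `(q³ + 1) q^{4n−3}` of the count of T5-SATAKE-KERNEL-p3.md row 11
(files 195–201 give `deg Tₙ = (Q q + 1) q (Q q²)^{n−1}` with `Q = #𝔽`, `q = #{t ∈ 𝔽 : t + t̄ = 0}`). Here the
involution `star` of `E` is read on the residue field `𝔽 = R/ϖ`:

* `starR` — the involution of `R` induced by `star` (a ring homomorphism, `starR (starR r) = r`, `starR ϖ = ϖ`);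
* **`residueStar`** — the induced involution `σ̄ : 𝔽 →+* 𝔽` (`σ̄ (residue r) = residue (starR r)`), and
  **`mem_traceZero_iff`** — the trace-zero part of file 196 is `{t : t + σ̄ t = 0}` (the trace lift
  `e + ē = 1` moves a class with `z + z̄ ∈ ϖ R` to a representative with `z + z̄ = 0`);
* `card_traceZero_mul_card_fixed` — `#{t : t + σ̄ t = 0} · #{t : σ̄ t = t} = #𝔽` (the additive map
  `t ↦ t + σ̄ t` has kernel the trace-zero part and image the fixed field, by the trace lift);
* `card_traceZero_eq_card_fixed` — `#{t : t + σ̄ t = 0} = #{t : σ̄ t = t}` as soon as `σ̄ ≠ 1` (multiplication by a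
  non-zero `t₀` with `σ̄ t₀ = −t₀`; in characteristic `2` the two sets coincide);
* **`card_residueField_eq_sq`** — `#𝔽 = #{t ∈ 𝔽 : t + t̄ = 0}²` when the residue involution is non-trivial
  (`hnt : ∃ x ∈ R, x − x̄ ∉ ϖ R`), i.e. `Q = q²`: the inert case.

Hypotheses: p8's standing ones, the trace lift `htr`, and the non-triviality `hnt` of the residue involution
(at an inert place `σ̄` is the Frobenius of `𝔽_{q²}/𝔽_q`: p8's T5-170).

Mathlib + this seat's file 196 and its imports; no display; no device.
§8(d): uses an L-value-free non-vanishing device: NO.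
-/

namespace Summit.Ventures.HodgeRepro2.T5InertResidueInvolution

open Summit.Ventures.HodgeRepro2.T5InertUnipotentResidue

/-! ## The involution of `R` induced by `star` -/

section StarR

variable {R E : Type*} [CommRing R] [Field E] [StarRing E] [Algebra R E] [IsFractionRing R E]
  (hstar : ∀ x : E, IsLocalization.IsInteger R x → IsLocalization.IsInteger R (star x))

omit [IsFractionRing R E] in
include hstar in
/-- The chosen preimage of `star (algebraMap r)`. -/
theorem algebraMap_choose_star (r : R) :
    algebraMap R E (Classical.choose (hstar _ ⟨r, rfl⟩)) = star (algebraMap R E r) :=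
  Classical.choose_spec (hstar _ ⟨r, rfl⟩)

/-- **The involution of `R` induced by `star`**, as a ring homomorphism. -/
noncomputable def starR : R →+* R where
  toFun r := Classical.choose (hstar _ ⟨r, rfl⟩)
  map_one' := by
    apply IsFractionRing.injective R E
    rw [algebraMap_choose_star hstar, map_one, star_one]
  map_mul' r s := by
    apply IsFractionRing.injective R E
    rw [algebraMap_choose_star hstar, map_mul, map_mul, algebraMap_choose_star hstar,
      algebraMap_choose_star hstar, star_mul, mul_comm]
  map_zero' := by
    apply IsFractionRing.injective R E
    rw [algebraMap_choose_star hstar, map_zero, star_zero]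
  map_add' r s := by
    apply IsFractionRing.injective R E
    rw [algebraMap_choose_star hstar, map_add, map_add, algebraMap_choose_star hstar,
      algebraMap_choose_star hstar, star_add]

/-- `algebraMap (starR r) = star (algebraMap r)`. -/
theorem algebraMap_starR (r : R) : algebraMap R E (starR hstar r) = star (algebraMap R E r) :=
  algebraMap_choose_star hstar r

/-- `starR` is an involution. -/
theorem starR_starR (r : R) : starR hstar (starR hstar r) = r := by
  apply IsFractionRing.injective R E
  rw [algebraMap_starR, algebraMap_starR, star_star]

/-- The trace lift, read in `R`: `e + starR e = 1`. -/
theorem exists_add_starR_eq_one (htr : ∃ e : R, algebraMap R E e + star (algebraMap R E e) = 1) :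
    ∃ e : R, e + starR hstar e = 1 := by
  obtain ⟨e, he⟩ := htr
  refine ⟨e, IsFractionRing.injective R E ?_⟩
  rw [map_add, algebraMap_starR, map_one, he]

end StarR

/-! ## The residue involution -/

section Residue

variable {R E : Type*} [CommRing R] [IsDomain R] [IsDiscreteValuationRing R] [Field E] [StarRing E]
  [Algebra R E] [IsFractionRing R E]
  (hstar : ∀ x : E, IsLocalization.IsInteger R x → IsLocalization.IsInteger R (star x))
  {ϖ : R} (hϖ : Irreducible ϖ) (hs : star (algebraMap R E ϖ) = algebraMap R E ϖ)

omit [IsDomain R] [IsDiscreteValuationRing R] in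
include hs in
/-- `starR ϖ = ϖ`. -/
theorem starR_uniformiser : starR hstar ϖ = ϖ := by
  apply IsFractionRing.injective R E
  rw [algebraMap_starR, hs]

/-- **The residue involution** `σ̄ : 𝔽 →+* 𝔽` induced by `star`. -/
noncomputable def residueStar : IsLocalRing.ResidueField R →+* IsLocalRing.ResidueField R :=
  Ideal.Quotient.lift (IsLocalRing.maximalIdeal R) ((IsLocalRing.residue R).comp (starR hstar)) (by
    intro a ha
    rw [hϖ.maximalIdeal_eq, Ideal.mem_span_singleton] at ha
    obtain ⟨y, rfl⟩ := ha
    rw [RingHom.comp_apply, map_mul, starR_uniformiser hstar hs, map_mul, residue_uniformiser hϖ, zero_mul])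

/-- `σ̄ (residue r) = residue (starR r)`. -/
theorem residueStar_residue (r : R) :
    residueStar hstar hϖ hs (IsLocalRing.residue R r) = IsLocalRing.residue R (starR hstar r) :=
  Ideal.Quotient.lift_mk _ _ _

/-- `σ̄` is an involution. -/
theorem residueStar_residueStar (t : IsLocalRing.ResidueField R) :
    residueStar hstar hϖ hs (residueStar hstar hϖ hs t) = t := by
  obtain ⟨r, rfl⟩ := IsLocalRing.residue_surjective t
  rw [residueStar_residue, residueStar_residue, starR_starR]

include hstar hϖ hs in
/-- A class `t = residue r` with `r + starR r ∈ ϖ R` has a representative `z` with `z + starR z = 0`. -/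
theorem exists_residue_eq_of_dvd (htr : ∃ e : R, algebraMap R E e + star (algebraMap R E e) = 1)
    {r : R} (h : ϖ ∣ r + starR hstar r) :
    ∃ z : R, IsLocalRing.residue R z = IsLocalRing.residue R r ∧ z + starR hstar z = 0 := by
  obtain ⟨e, he⟩ := exists_add_starR_eq_one hstar htr
  obtain ⟨w, hw⟩ := h
  -- `w` is `starR`-fixed
  have hw' : starR hstar w = w := by
    have h1 : ϖ * starR hstar w = ϖ * w := by
      rw [← starR_uniformiser hstar hs, ← map_mul, starR_uniformiser hstar hs, ← hw, map_add, starR_starR,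
        add_comm]
    exact mul_left_cancel₀ hϖ.ne_zero h1
  refine ⟨r - e * ϖ * w, ?_, ?_⟩
  · rw [map_sub, map_mul, map_mul, residue_uniformiser hϖ, mul_zero, zero_mul, sub_zero]
  · rw [map_sub, map_mul, map_mul, starR_uniformiser hstar hs, hw']
    linear_combination hw - ϖ * w * he

include hstar hϖ hs in
/-- **The trace-zero part of `𝔽` is `{t : t + σ̄ t = 0}`** (given the trace lift). -/
theorem mem_traceZero_iff (htr : ∃ e : R, algebraMap R E e + star (algebraMap R E e) = 1)
    (t : IsLocalRing.ResidueField R) :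
    t ∈ traceZero R E ↔ t + residueStar hstar hϖ hs t = 0 := by
  constructor
  · rintro ⟨z, rfl, hz⟩
    have hz' : z + starR hstar z = 0 := by
      apply IsFractionRing.injective R E
      rw [map_add, algebraMap_starR, map_zero, hz]
    rw [residueStar_residue, ← map_add, hz', map_zero]
  · intro h
    obtain ⟨r, rfl⟩ := IsLocalRing.residue_surjective t
    rw [residueStar_residue, ← map_add, residue_eq_zero_iff_dvd hϖ] at h
    obtain ⟨z, hz, hz'⟩ := exists_residue_eq_of_dvd hstar hϖ hs htr h
    refine ⟨z, hz, ?_⟩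
    rw [← algebraMap_starR hstar, ← map_add, hz', map_zero]

/-! ## The two counts: `#T · #F₀ = #𝔽` and `#T = #F₀` -/

/-- The fixed field of the residue involution, as a set. -/
def fixedSet (hstar : ∀ x : E, IsLocalization.IsInteger R x → IsLocalization.IsInteger R (star x))
    (hϖ : Irreducible ϖ) (hs : star (algebraMap R E ϖ) = algebraMap R E ϖ) :
    Set (IsLocalRing.ResidueField R) :=
  {t | residueStar hstar hϖ hs t = t}

/-- The additive map `t ↦ t + σ̄ t`. -/
noncomputable def tracePlus : IsLocalRing.ResidueField R →+ IsLocalRing.ResidueField R :=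
  AddMonoidHom.id _ + (residueStar hstar hϖ hs).toAddMonoidHom

/-- `tracePlus t = t + σ̄ t`. -/
theorem tracePlus_apply (t : IsLocalRing.ResidueField R) :
    tracePlus hstar hϖ hs t = t + residueStar hstar hϖ hs t := rfl

/-- The kernel of `t ↦ t + σ̄ t` is the trace-zero part. -/
theorem ker_tracePlus (htr : ∃ e : R, algebraMap R E e + star (algebraMap R E e) = 1) :
    ((tracePlus hstar hϖ hs).ker : Set (IsLocalRing.ResidueField R)) = traceZero R E := by
  ext t
  rw [SetLike.mem_coe, AddMonoidHom.mem_ker, tracePlus_apply, mem_traceZero_iff hstar hϖ hs htr]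

/-- The image of `t ↦ t + σ̄ t` is the fixed field (the trace lift `e` gives `t = (e t) + σ̄ (e t)` for
`σ̄ t = t`). -/
theorem range_tracePlus (htr : ∃ e : R, algebraMap R E e + star (algebraMap R E e) = 1) :
    ((tracePlus hstar hϖ hs).range : Set (IsLocalRing.ResidueField R)) = fixedSet hstar hϖ hs := by
  obtain ⟨e, he⟩ := exists_add_starR_eq_one hstar htr
  ext t
  rw [SetLike.mem_coe, AddMonoidHom.mem_range]
  constructor
  · rintro ⟨s, rfl⟩
    show residueStar hstar hϖ hs (s + residueStar hstar hϖ hs s) = s + residueStar hstar hϖ hs s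
    rw [map_add, residueStar_residueStar, add_comm]
  · intro ht
    change residueStar hstar hϖ hs t = t at ht
    refine ⟨IsLocalRing.residue R e * t, ?_⟩
    rw [tracePlus_apply, map_mul, residueStar_residue, ht, ← add_mul, ← map_add, he, map_one, one_mul]

/-- **`#{t : t + σ̄ t = 0} · #{t : σ̄ t = t} = #𝔽`.** -/
theorem card_traceZero_mul_card_fixed (htr : ∃ e : R, algebraMap R E e + star (algebraMap R E e) = 1) :
    Nat.card (traceZero R E) * Nat.card (fixedSet hstar hϖ hs) = Nat.card (IsLocalRing.ResidueField R) := by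
  have h := AddSubgroup.card_mul_index (tracePlus hstar hϖ hs).ker
  rw [AddSubgroup.index_ker] at h
  rw [← h]
  congr 1
  · exact Nat.card_congr (Equiv.setCongr (ker_tracePlus hstar hϖ hs htr)).symm
  · exact Nat.card_congr (Equiv.setCongr (range_tracePlus hstar hϖ hs htr)).symm

/-- **`#{t : t + σ̄ t = 0} = #{t : σ̄ t = t}`** as soon as `σ̄ ≠ 1`: in characteristic `2` the sets coincide;
otherwise multiplication by a non-zero `t₀` with `σ̄ t₀ = −t₀` is a bijection. -/
theorem card_traceZero_eq_card_fixed (htr : ∃ e : R, algebraMap R E e + star (algebraMap R E e) = 1)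
    (hnt : ∃ t : IsLocalRing.ResidueField R, residueStar hstar hϖ hs t ≠ t) :
    Nat.card (traceZero R E) = Nat.card (fixedSet hstar hϖ hs) := by
  have hT : traceZero R E = {t | residueStar hstar hϖ hs t = -t} := by
    ext t
    rw [mem_traceZero_iff hstar hϖ hs htr, Set.mem_setOf_eq, add_eq_zero_iff_neg_eq, eq_comm]
  rw [hT]
  by_cases h2 : (2 : IsLocalRing.ResidueField R) = 0
  · -- characteristic `2`: `−t = t`
    have hneg : ∀ y : IsLocalRing.ResidueField R, -y = y := fun y => by
      rw [neg_eq_iff_add_eq_zero, ← two_mul, h2, zero_mul]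
    have hset : {t | residueStar hstar hϖ hs t = -t} = fixedSet hstar hϖ hs := by
      ext t
      simp only [Set.mem_setOf_eq, hneg]
      exact Iff.rfl
    rw [hset]
  · obtain ⟨x, hx⟩ := hnt
    set t₀ : IsLocalRing.ResidueField R := x - residueStar hstar hϖ hs x with ht₀
    have ht₀0 : t₀ ≠ 0 := sub_ne_zero.2 (Ne.symm hx)
    have hst₀ : residueStar hstar hϖ hs t₀ = -t₀ := by
      rw [ht₀, map_sub, residueStar_residueStar, neg_sub]
    symm
    refine Nat.card_congr
      { toFun := fun t => ⟨t * t₀, ?_⟩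
        invFun := fun s => ⟨s * t₀⁻¹, ?_⟩
        left_inv := fun t => ?_
        right_inv := fun s => ?_ }
    · have ht : residueStar hstar hϖ hs t = t := t.2
      show residueStar hstar hϖ hs (t * t₀) = -(t * t₀)
      rw [map_mul, ht, hst₀, mul_neg]
    · have hs' : residueStar hstar hϖ hs s = -s := s.2
      show residueStar hstar hϖ hs (s * t₀⁻¹) = s * t₀⁻¹
      rw [map_mul, hs', map_inv₀, hst₀, neg_mul, inv_neg, mul_neg, neg_neg]
    · apply Subtype.ext
      show (t : IsLocalRing.ResidueField R) * t₀ * t₀⁻¹ = t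
      rw [mul_inv_cancel_right₀ ht₀0]
    · apply Subtype.ext
      show (s : IsLocalRing.ResidueField R) * t₀⁻¹ * t₀ = s
      rw [inv_mul_cancel_right₀ ht₀0]

/-- **`#𝔽 = #{t ∈ 𝔽 : t + t̄ = 0}²`** when the residue involution is non-trivial (`Q = q²`). -/
theorem card_residueField_eq_sq (htr : ∃ e : R, algebraMap R E e + star (algebraMap R E e) = 1)
    (hnt : ∃ t : IsLocalRing.ResidueField R, residueStar hstar hϖ hs t ≠ t) :
    Nat.card (IsLocalRing.ResidueField R) = Nat.card (traceZero R E) ^ 2 := by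
  rw [← card_traceZero_mul_card_fixed hstar hϖ hs htr, ← card_traceZero_eq_card_fixed hstar hϖ hs htr hnt,
    sq]

include hstar hϖ hs in
/-- The non-triviality of the residue involution, from an integral `x` with `x − x̄ ∉ ϖ R`. -/
theorem exists_residueStar_ne (hnt : ∃ x : R, ¬ IsLocalization.IsInteger R
      ((algebraMap R E x - star (algebraMap R E x)) * (algebraMap R E ϖ)⁻¹)) :
    ∃ t : IsLocalRing.ResidueField R, residueStar hstar hϖ hs t ≠ t := by
  obtain ⟨x, hx⟩ := hnt
  refine ⟨IsLocalRing.residue R x, fun h => hx ?_⟩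
  rw [residueStar_residue, eq_comm, ← sub_eq_zero, ← map_sub, residue_eq_zero_iff_dvd hϖ] at h
  obtain ⟨y, hy⟩ := h
  refine ⟨y, ?_⟩
  have hπ0 : algebraMap R E ϖ ≠ 0 :=
    (map_ne_zero_iff _ (IsFractionRing.injective R E)).2 hϖ.ne_zero
  rw [← algebraMap_starR hstar, ← map_sub, hy, map_mul, mul_comm, ← mul_assoc, inv_mul_cancel₀ hπ0, one_mul]

end Residue

end Summit.Ventures.HodgeRepro2.T5InertResidueInvolution
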